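import Summits.Ventures.Crystal3D.Theorems.StickyWulffConstantNoReconstructionGainLowCoordAdhesion
import HarnessLib

/-!
# The NRG transport certificate: potential form, flow form, and the telescoping reduction

HONEST FRAMING. Part of the venture `Summits/Ventures/Crystal3D` (cell `crystal3d-full`), helper
`--supports` the crux `NoReconstructionGain` (stmt-Ventures-19144, route
`route-Ventures-StickyWulffConstant`), line `adhesion`.  This file lands, def-free, the
certificate SHAPE the planners converged on (cf-p1 R21 «T1 compass / T2 absorption / T3 boundary»,
cf-p2 R26 `AdhesionOfPotential.lean`): for a finite unit packing `X ⊇ P` (`P` = the substrate /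
slab sample, `Q = X \ P` = the film) and an integer potential `Φ` on the film, the per-ball
no-gain inequality **(T2)** at a film ball `q` is

`#{x ∈ Q : x ∼ q, Φ x < Φ q} + #{p ∈ P : p ∼ q} ≤ (12 − #{x ∈ X : x ∼ q}) + #{x ∈ Q : x ∼ q, Φ q < Φ x}`

(`∼` = distance exactly `1`; unit charge per bond, orientation = sign of `ΔΦ`, level bonds carry
nothing, the substrate sits at `−∞`).  Proved here:

* `noGainPotential_iff` — (T2) `⟺ 2·#below + 2·#plug + #level ≤ 12` (the form in which
  heredity and max-closure are evident);
* `adhesion_of_flow` — FLOW form: any antisymmetric transfer `t` with `t ≤ 1` on film–film bonds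
  satisfying `#plug(q) + Σ_{x ∼ q} t x q ≤ 12 − deg q` at every film ball off a rim set `E`
  gives `#cross(P, Q) ≤ D(Q) + 6·#E` (telescoping: the transfers cancel in the sum over `Q`, the
  rim balls are bounded by the kissing number `card_partners_le_twelve`);
* `adhesion_of_potential` (binder form `cross_le_of_potential`) — the same from a potential
  certificate (`t x q = sign (Φ q − Φ x)`);
* `noGainPotential_mono` (heredity under deleting film balls) and `noGainPotential_max`
  (feasible potentials are closed under pointwise `max`, so a greatest feasible labelling exists).

WHAT THIS IS NOT: existence of a certificate for any class of films (that is the content of the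
crux; census R26, HOME/cf-p2/jobs/r26, found one for 8 037 / 8 037 films); rung F-C1 not moved.
-/

noncomputable section

namespace Summit.Ventures.Crystal3D.Theorems

open Summit.Ventures.Crystal3D Finset
open Literature.MathematicalPhysics.StatisticalMechanics (orderedContacts contactDeficiency)

/-! ### Counting partners -/

/-- Partners of `q` in `X` split into substrate partners and film partners (`P ⊆ X`). -/
theorem card_partners_eq_plug_add_film (X P : Finset (EuclideanSpace ℝ (Fin 3))) (hPX : P ⊆ X)
    (q : EuclideanSpace ℝ (Fin 3)) :
    (X.filter fun x => dist q x = 1).card =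
      (P.filter fun p => dist q p = 1).card + ((X \ P).filter fun x => dist q x = 1).card := by
  classical
  rw [← card_union_of_disjoint (disjoint_filter_filter (disjoint_sdiff (s := P) (t := X)).symm.symm)]
  · congr 1
    rw [← filter_union, union_sdiff_of_subset hPX]

/-- Film partners of `q` split by the sign of `Φ x − Φ q`: below, above, level. -/
theorem card_film_partners_eq (Q : Finset (EuclideanSpace ℝ (Fin 3))) (Φ : EuclideanSpace ℝ (Fin 3) → ℤ)
    (q : EuclideanSpace ℝ (Fin 3)) :
    (Q.filter fun x => dist q x = 1).card =
      (Q.filter fun x => dist q x = 1 ∧ Φ x < Φ q).card +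
        (Q.filter fun x => dist q x = 1 ∧ Φ q < Φ x).card +
        (Q.filter fun x => dist q x = 1 ∧ Φ x = Φ q).card := by
  classical
  simp only [card_filter, ← sum_add_distrib]
  refine sum_congr rfl fun x _ => ?_
  by_cases h : dist q x = 1
  · rcases lt_trichotomy (Φ x) (Φ q) with hlt | heq | hgt
    · simp [h, hlt, hlt.ne, not_lt.2 hlt.le]
    · simp [h, heq]
    · simp [h, hgt, hgt.ne', not_lt.2 hgt.le]
  · simp [h]

/-- **(T2) in symmetric form.**  For `P ⊆ X` and `Q = X \ P`, the potential-form no-gain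
inequality at `q` is equivalent to `2·#below + 2·#plug + #level ≤ 12`. -/
theorem noGainPotential_iff (X P : Finset (EuclideanSpace ℝ (Fin 3))) (hPX : P ⊆ X)
    (Φ : EuclideanSpace ℝ (Fin 3) → ℤ) (q : EuclideanSpace ℝ (Fin 3)) :
    ((((X \ P).filter fun x => dist q x = 1 ∧ Φ x < Φ q).card : ℤ)
        + ((P.filter fun p => dist q p = 1).card : ℤ)
      ≤ (12 - ((X.filter fun x => dist q x = 1).card : ℤ))
        + (((X \ P).filter fun x => dist q x = 1 ∧ Φ q < Φ x).card : ℤ)) ↔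
    2 * (((X \ P).filter fun x => dist q x = 1 ∧ Φ x < Φ q).card : ℤ)
      + 2 * ((P.filter fun p => dist q p = 1).card : ℤ)
      + (((X \ P).filter fun x => dist q x = 1 ∧ Φ x = Φ q).card : ℤ) ≤ 12 := by
  have h1 := card_partners_eq_plug_add_film X P hPX q
  have h2 := card_film_partners_eq (X \ P) Φ q
  zify at h1 h2
  constructor <;> intro h <;> linarith

/-! ### Global identities -/

/-- The cross-contact count is the sum over the film of the number of substrate partners. -/
theorem card_cross_eq_sum_card_plug_partners (P Q : Finset (EuclideanSpace ℝ (Fin 3))) :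
    (((P ×ˢ Q).filter fun pq => dist pq.1 pq.2 = 1).card : ℝ) =
      ∑ q ∈ Q, ((P.filter fun p => dist q p = 1).card : ℝ) := by
  classical
  rw [card_crossContacts_eq_sum_sum, sum_comm]
  refine sum_congr rfl fun q _ => ?_
  rw [card_filter, Nat.cast_sum]
  refine sum_congr rfl fun p _ => ?_
  rw [dist_comm]; split_ifs <;> simp

/-- `orderedContacts Q` is the sum over `Q` of the number of partners inside `Q`. -/
theorem orderedContacts_eq_sum_card_partners (Q : Finset (EuclideanSpace ℝ (Fin 3))) :
    (orderedContacts Q : ℝ) = ∑ q ∈ Q, ((Q.filter fun x => dist q x = 1).card : ℝ) := by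
  classical
  rw [orderedContacts_eq_sum_sum]
  refine sum_congr rfl fun q _ => ?_
  rw [card_filter, Nat.cast_sum]
  refine sum_congr rfl fun p _ => ?_
  split_ifs <;> simp

/-- An antisymmetric transfer sums to zero over the (symmetric) film–film contact relation. -/
theorem sum_sum_transfer_eq_zero (Q : Finset (EuclideanSpace ℝ (Fin 3)))
    (t : EuclideanSpace ℝ (Fin 3) → EuclideanSpace ℝ (Fin 3) → ℤ) (ht : ∀ x y, t x y = -t y x) :
    ∑ q ∈ Q, ∑ x ∈ Q.filter (fun x => dist q x = 1), t x q = 0 := by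
  classical
  have key : ∀ q ∈ Q, ∑ x ∈ Q.filter (fun x => dist q x = 1), t x q =
      ∑ x ∈ Q, (if dist q x = 1 then t x q else 0) := fun q _ => by rw [sum_filter]
  rw [sum_congr rfl key]
  set S := ∑ q ∈ Q, ∑ x ∈ Q, (if dist q x = 1 then t x q else 0) with hS
  have hneg : S = -S := by
    conv_lhs => rw [hS, sum_comm]
    rw [hS, ← sum_neg_distrib]
    refine sum_congr rfl fun q _ => ?_
    rw [← sum_neg_distrib]
    refine sum_congr rfl fun x _ => ?_
    rw [dist_comm]
    split_ifs
    · rw [ht]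
    · simp
  linarith

/-! ### The telescoping reduction -/

/-- **`adhesion_of_flow`** (flow form of the certificate).  `X` a finite unit packing, `P ⊆ X`
the substrate, `E ⊆ X \ P` a rim set, `t` an antisymmetric integer transfer with `t ≤ 1`.  If at
every film ball `q ∉ E`
`#{p ∈ P : p ∼ q} + Σ_{x ∈ X \ P, x ∼ q} t x q ≤ 12 − #{x ∈ X : x ∼ q}`,
then `#{(p, q) ∈ P × (X \ P) : dist p q = 1} ≤ contactDeficiency (X \ P) + 6·#E`. -/
theorem adhesion_of_flow (X P E : Finset (EuclideanSpace ℝ (Fin 3)))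
    (hX : ∀ p ∈ X, ∀ q ∈ X, p ≠ q → 1 ≤ dist p q) (hPX : P ⊆ X) (hE : E ⊆ X \ P)
    (t : EuclideanSpace ℝ (Fin 3) → EuclideanSpace ℝ (Fin 3) → ℤ)
    (ht_anti : ∀ x y, t x y = -t y x) (ht_le : ∀ x y, t x y ≤ 1)
    (hT2 : ∀ q ∈ (X \ P) \ E,
      ((P.filter fun p => dist q p = 1).card : ℤ)
          + ∑ x ∈ (X \ P).filter (fun x => dist q x = 1), t x q
        ≤ 12 - ((X.filter fun x => dist q x = 1).card : ℤ)) :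
    ((((P ×ˢ (X \ P)).filter fun pq => dist pq.1 pq.2 = 1).card : ℕ) : ℝ) ≤
      contactDeficiency (X \ P) + 6 * (E.card : ℝ) := by
  classical
  -- abbreviations for the per-ball counts (as real numbers)
  set c : EuclideanSpace ℝ (Fin 3) → ℝ := fun q => ((P.filter fun p => dist q p = 1).card : ℝ)
    with hc
  set d : EuclideanSpace ℝ (Fin 3) → ℝ := fun q =>
    (((X \ P).filter fun x => dist q x = 1).card : ℝ) with hd
  set s : EuclideanSpace ℝ (Fin 3) → ℝ := fun q =>
    ((∑ x ∈ (X \ P).filter (fun x => dist q x = 1), t x q : ℤ) : ℝ) with hs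
  have hcross : ((((P ×ˢ (X \ P)).filter fun pq => dist pq.1 pq.2 = 1).card : ℕ) : ℝ) =
      ∑ q ∈ X \ P, c q := card_cross_eq_sum_card_plug_partners P (X \ P)
  have hord : (orderedContacts (X \ P) : ℝ) = ∑ q ∈ X \ P, d q :=
    orderedContacts_eq_sum_card_partners (X \ P)
  have hdef : contactDeficiency (X \ P) =
      6 * ((X \ P).card : ℝ) - (orderedContacts (X \ P) : ℝ) / 2 := rfl
  -- per-ball facts
  have hdeg : ∀ q, ((X.filter fun x => dist q x = 1).card : ℝ) = c q + d q := fun q => by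
    have := card_partners_eq_plug_add_film X P hPX q
    simp only [hc, hd]; exact_mod_cast this
  have hkiss : ∀ q, c q + d q ≤ 12 := fun q => by
    rw [← hdeg]; exact_mod_cast card_partners_le_twelve X hX q
  have hc0 : ∀ q, 0 ≤ c q := fun q => Nat.cast_nonneg _
  -- transfers: total zero, and bounded by the film degree at every ball
  have hs0 : ∑ q ∈ X \ P, s q = 0 := by
    show ∑ q ∈ X \ P, ((∑ x ∈ (X \ P).filter (fun x => dist q x = 1), t x q : ℤ) : ℝ) = 0
    rw [← Int.cast_sum, sum_sum_transfer_eq_zero (X \ P) t ht_anti, Int.cast_zero]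
  have hsle : ∀ q, s q ≤ d q := fun q => by
    simp only [hs, hd]
    have : (∑ x ∈ (X \ P).filter (fun x => dist q x = 1), t x q : ℤ) ≤
        ∑ x ∈ (X \ P).filter (fun x => dist q x = 1), (1 : ℤ) := sum_le_sum fun x _ => ht_le x q
    rw [sum_const, nsmul_eq_mul, mul_one] at this
    exact_mod_cast this
  -- (T2) summed over the film off the rim
  have hT2' : ∀ q ∈ (X \ P) \ E, c q + s q ≤ 12 - (c q + d q) := fun q hq => by
    have h := hT2 q hq
    rw [← hdeg]; simp only [hc, hs]; exact_mod_cast h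
  have hsplit : ∀ f : EuclideanSpace ℝ (Fin 3) → ℝ,
      ∑ q ∈ X \ P, f q = ∑ q ∈ (X \ P) \ E, f q + ∑ q ∈ E, f q := fun f => by
    rw [← sum_sdiff hE]
  have h1 : ∑ q ∈ (X \ P) \ E, (c q + s q) ≤ ∑ q ∈ (X \ P) \ E, (12 - (c q + d q)) :=
    sum_le_sum hT2'
  have h2 : ∑ q ∈ (X \ P) \ E, s q = -∑ q ∈ E, s q := by
    have := hsplit s; linarith
  have h3 : ∑ q ∈ E, s q ≤ ∑ q ∈ E, d q := sum_le_sum fun q _ => hsle q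
  have h4 : ∑ q ∈ E, (c q + d q) ≤ ∑ q ∈ E, (12 : ℝ) := sum_le_sum fun q _ => hkiss q
  have h5 : (0 : ℝ) ≤ ∑ q ∈ E, c q := sum_nonneg fun q _ => hc0 q
  have hcardQ : (((X \ P) \ E).card : ℝ) + (E.card : ℝ) = (X \ P).card := by
    rw [← Nat.cast_add, card_sdiff_add_card_eq_card hE]
  -- assemble
  rw [hcross, hdef, hord, hsplit c, hsplit d]
  simp only [sum_add_distrib, sum_sub_distrib, sum_const, nsmul_eq_mul] at h1 h4 ⊢
  linarith [h1, h2, h3, h4, h5, hcardQ]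

/-- A potential certificate is a flow certificate with `t x q = sign (Φ q − Φ x)`: the transfer
sum at `q` is `#below − #above`. -/
theorem sum_sign_sub_eq (Q : Finset (EuclideanSpace ℝ (Fin 3))) (Φ : EuclideanSpace ℝ (Fin 3) → ℤ)
    (q : EuclideanSpace ℝ (Fin 3)) :
    ∑ x ∈ Q.filter (fun x => dist q x = 1), Int.sign (Φ q - Φ x) =
      ((Q.filter fun x => dist q x = 1 ∧ Φ x < Φ q).card : ℤ) -
        ((Q.filter fun x => dist q x = 1 ∧ Φ q < Φ x).card : ℤ) := by
  classical
  rw [sum_filter]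
  simp only [card_filter, Nat.cast_sum, ← sum_sub_distrib]
  refine sum_congr rfl fun x _ => ?_
  by_cases h : dist q x = 1
  · rcases lt_trichotomy (Φ x) (Φ q) with hlt | heq | hgt
    · simp [h, hlt, not_lt.2 hlt.le, Int.sign_eq_one_of_pos (sub_pos.2 hlt)]
    · simp [h, heq]
    · simp [h, hgt, not_lt.2 hgt.le, Int.sign_eq_neg_one_of_neg (sub_neg.2 hgt)]
  · simp [h]

/-- The sign of an integer is at most one. -/
theorem sign_le_one' (z : ℤ) : Int.sign z ≤ 1 := by
  rcases lt_trichotomy z 0 with h | h | h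
  · rw [Int.sign_eq_neg_one_of_neg h]; decide
  · rw [h]; decide
  · rw [Int.sign_eq_one_of_pos h]

/-- **The R26 certificate ⇒ the adhesion atom** (binder form).  `X` a finite unit packing,
`P ⊆ X`, `E ⊆ X \ P` a rim set, `Φ` an integer potential satisfying (T2) at every film ball off
`E`.  Then `#{(p, q) ∈ P × (X \ P) : dist p q = 1} ≤ contactDeficiency (X \ P) + 6·#E`. -/
theorem cross_le_of_potential (X P E : Finset (EuclideanSpace ℝ (Fin 3)))
    (hX : ∀ p ∈ X, ∀ q ∈ X, p ≠ q → 1 ≤ dist p q) (hPX : P ⊆ X) (hE : E ⊆ X \ P)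
    (Φ : EuclideanSpace ℝ (Fin 3) → ℤ)
    (hT2 : ∀ q ∈ (X \ P) \ E,
      (((X \ P).filter fun x => dist q x = 1 ∧ Φ x < Φ q).card : ℤ)
          + ((P.filter fun p => dist q p = 1).card : ℤ)
        ≤ (12 - ((X.filter fun x => dist q x = 1).card : ℤ))
          + (((X \ P).filter fun x => dist q x = 1 ∧ Φ q < Φ x).card : ℤ)) :
    ((((P ×ˢ (X \ P)).filter fun pq => dist pq.1 pq.2 = 1).card : ℕ) : ℝ) ≤
      contactDeficiency (X \ P) + 6 * (E.card : ℝ) := by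
  refine adhesion_of_flow X P E hX hPX hE (fun x y => Int.sign (Φ y - Φ x))
    (fun x y => ?_) (fun x y => sign_le_one' _) (fun q hq => ?_)
  · rw [← Int.sign_neg, neg_sub]
  · rw [sum_sign_sub_eq]
    have := hT2 q hq
    linarith

/-- **`adhesion_of_potential`** — the telescoping reduction in the registered (closed) form
(R26 target typed by planner cf-p2; stub registered by name on stmt-Ventures-19144): a potential
certificate off a rim set `E` gives `#cross(P, X \ P) ≤ contactDeficiency (X \ P) + 6·#E`. -/
theorem adhesion_of_potential : ∀ X P E : Finset (EuclideanSpace ℝ (Fin 3)),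
    (∀ p ∈ X, ∀ q ∈ X, p ≠ q → 1 ≤ dist p q) → P ⊆ X → E ⊆ X \ P →
    ∀ Φ : EuclideanSpace ℝ (Fin 3) → ℤ, (∀ q ∈ (X \ P) \ E,
      (((X \ P).filter fun x => dist q x = 1 ∧ Φ x < Φ q).card : ℤ)
        + ((P.filter fun p => dist q p = 1).card : ℤ)
      ≤ (12 - ((X.filter fun x => dist q x = 1).card : ℤ))
        + (((X \ P).filter fun x => dist q x = 1 ∧ Φ q < Φ x).card : ℤ)) →
    ((((P ×ˢ (X \ P)).filter fun pq => dist pq.1 pq.2 = 1).card : ℕ) : ℝ) ≤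
      contactDeficiency (X \ P) + 6 * (E.card : ℝ) :=
  fun X P E hX hPX hE Φ hT2 => cross_le_of_potential X P E hX hPX hE Φ hT2

/-! ### Structure of the feasible set: heredity and max-closure -/

/-- **Heredity.**  Deleting film balls keeps (T2): if `P ⊆ Y ⊆ X` and `Φ` satisfies (T2) at `q`
relative to `X`, it satisfies (T2) at `q` relative to `Y`. -/
theorem noGainPotential_mono (X Y P : Finset (EuclideanSpace ℝ (Fin 3))) (hPY : P ⊆ Y) (hYX : Y ⊆ X)
    (Φ : EuclideanSpace ℝ (Fin 3) → ℤ) (q : EuclideanSpace ℝ (Fin 3))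
    (h : (((X \ P).filter fun x => dist q x = 1 ∧ Φ x < Φ q).card : ℤ)
          + ((P.filter fun p => dist q p = 1).card : ℤ)
        ≤ (12 - ((X.filter fun x => dist q x = 1).card : ℤ))
          + (((X \ P).filter fun x => dist q x = 1 ∧ Φ q < Φ x).card : ℤ)) :
    (((Y \ P).filter fun x => dist q x = 1 ∧ Φ x < Φ q).card : ℤ)
        + ((P.filter fun p => dist q p = 1).card : ℤ)
      ≤ (12 - ((Y.filter fun x => dist q x = 1).card : ℤ))
        + (((Y \ P).filter fun x => dist q x = 1 ∧ Φ q < Φ x).card : ℤ) := by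
  classical
  rw [noGainPotential_iff X P (hPY.trans hYX) Φ q] at h
  rw [noGainPotential_iff Y P hPY Φ q]
  have hsub : Y \ P ⊆ X \ P := sdiff_subset_sdiff hYX le_rfl
  have hb : ((Y \ P).filter fun x => dist q x = 1 ∧ Φ x < Φ q).card ≤
      ((X \ P).filter fun x => dist q x = 1 ∧ Φ x < Φ q).card :=
    card_le_card (filter_subset_filter _ hsub)
  have hl : ((Y \ P).filter fun x => dist q x = 1 ∧ Φ x = Φ q).card ≤
      ((X \ P).filter fun x => dist q x = 1 ∧ Φ x = Φ q).card :=
    card_le_card (filter_subset_filter _ hsub)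
  zify at hb hl
  linarith

/-- **Max-closure.**  If `Φ` and `Ψ` both satisfy (T2) at `q`, so does `max Φ Ψ`.  (At `q` with,
say, `Φ q ≥ Ψ q`: `below_max ⊆ below_Φ` and `below_max ∪ level_max ⊆ below_Φ ∪ level_Φ`.)  Hence the
feasible potentials on a film form an upper semilattice and a greatest normalised one exists. -/
theorem noGainPotential_max (X P : Finset (EuclideanSpace ℝ (Fin 3))) (hPX : P ⊆ X)
    (Φ Ψ : EuclideanSpace ℝ (Fin 3) → ℤ) (q : EuclideanSpace ℝ (Fin 3))
    (hΦ : (((X \ P).filter fun x => dist q x = 1 ∧ Φ x < Φ q).card : ℤ)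
          + ((P.filter fun p => dist q p = 1).card : ℤ)
        ≤ (12 - ((X.filter fun x => dist q x = 1).card : ℤ))
          + (((X \ P).filter fun x => dist q x = 1 ∧ Φ q < Φ x).card : ℤ))
    (hΨ : (((X \ P).filter fun x => dist q x = 1 ∧ Ψ x < Ψ q).card : ℤ)
          + ((P.filter fun p => dist q p = 1).card : ℤ)
        ≤ (12 - ((X.filter fun x => dist q x = 1).card : ℤ))
          + (((X \ P).filter fun x => dist q x = 1 ∧ Ψ q < Ψ x).card : ℤ)) :
    (((X \ P).filter fun x => dist q x = 1 ∧ max (Φ x) (Ψ x) < max (Φ q) (Ψ q)).card : ℤ)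
        + ((P.filter fun p => dist q p = 1).card : ℤ)
      ≤ (12 - ((X.filter fun x => dist q x = 1).card : ℤ))
        + (((X \ P).filter fun x => dist q x = 1 ∧ max (Φ q) (Ψ q) < max (Φ x) (Ψ x)).card : ℤ) := by
  classical
  -- by symmetry assume `Ψ q ≤ Φ q`
  wlog hle : Ψ q ≤ Φ q generalizing Φ Ψ
  · have h := this Ψ Φ hΨ hΦ ((not_le.1 hle).le)
    simp only [max_comm (Ψ _) (Φ _)] at h
    exact h
  rw [noGainPotential_iff X P hPX (fun x => max (Φ x) (Ψ x)) q]
  rw [noGainPotential_iff X P hPX Φ q] at hΦ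
  set Q := X \ P
  have hmq : max (Φ q) (Ψ q) = Φ q := max_eq_left hle
  -- `#below_max + #(below_max ∪ level_max) ≤ #below_Φ + #(below_Φ ∪ level_Φ)`
  have hA : (Q.filter fun x => dist q x = 1 ∧ max (Φ x) (Ψ x) < max (Φ q) (Ψ q)).card ≤
      (Q.filter fun x => dist q x = 1 ∧ Φ x < Φ q).card := by
    refine card_le_card fun x hx => ?_
    simp only [mem_filter, hmq] at hx ⊢
    exact ⟨hx.1, hx.2.1, lt_of_le_of_lt (le_max_left _ _) hx.2.2⟩
  have hB : (Q.filter fun x => dist q x = 1 ∧ max (Φ x) (Ψ x) < max (Φ q) (Ψ q)).card +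
      (Q.filter fun x => dist q x = 1 ∧ max (Φ x) (Ψ x) = max (Φ q) (Ψ q)).card ≤
      (Q.filter fun x => dist q x = 1 ∧ Φ x < Φ q).card +
      (Q.filter fun x => dist q x = 1 ∧ Φ x = Φ q).card := by
    rw [← card_union_of_disjoint, ← card_union_of_disjoint]
    · refine card_le_card fun x hx => ?_
      simp only [mem_union, mem_filter, hmq] at hx ⊢
      rcases hx with ⟨hxQ, hd, hlt⟩ | ⟨hxQ, hd, heq⟩
      · exact Or.inl ⟨hxQ, hd, lt_of_le_of_lt (le_max_left _ _) hlt⟩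
      · rcases (le_max_left (Φ x) (Ψ x)).lt_or_eq with h | h
        · exact Or.inl ⟨hxQ, hd, by rw [← heq]; exact h⟩
        · exact Or.inr ⟨hxQ, hd, by rw [h, heq]⟩
    · exact disjoint_filter.2 fun x _ h1 h2 => by rw [h2.2] at h1; exact lt_irrefl _ h1.2
    · exact disjoint_filter.2 fun x _ h1 h2 => by rw [h2.2] at h1; exact lt_irrefl _ h1.2
  zify at hA hB
  linarith

end Summit.Ventures.Crystal3D.Theorems
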